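/-
Origin: expansion seat `planner-pub-hodgecm-mc-axioms-1-g14-0`, handover #W222 2026-08-20T15:53:55Z md5 f4ccf349ef4a (PKG dc8b4d079a9a → f4ccf349ef4a; 188 l.; MECHANICAL (iib-R) rewrite v3.1 of the PKG file as it stands (10 token edits; rules R1x1+RX[h₂]x9)) (`HOME/mc/pub-hodgecm-mc-axioms-1-g14/revendor/kit-r55/stage55/HodgeCM/Model/Binders/Real34ConcreteInsP2.lean`, md5 f4ccf349ef4a, 188 lines);
landed by the gen-22 packager (p-g22) in gate run 55 REPLACES the earlier landed copy of `HodgeCM/Model/Binders/Real34ConcreteInsP2.lean` (seat copy carried the packager Origin header of an earlier run (stripped)).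
-/
/-
Origin: speedrun cell pub-hodgecm, MODEL-CONSTRUCTION sub-cell, unit pub-hodgecm-mc-binder-1-g13 (BINDER PROVER, gen 13; S RE-PIN P2 = the R2 shape:
binder-1's P-pin module `Binders/Real34ConcreteIns` re-typed at sinst-1's PREDICATE-GUARDED DOUBLY-TWISTED pin `SInstance.SGPT' @G @hG @hGR @η @hη @hηc @ν @hν @hνc
@ν' @hν' @hν'c @hGR₀..₃ @AG` (#1228 `ThetaAdelicSideGuardedT2`; E's R2 pin `SROGT'CJ` is its instance), exactly as gen 10 re-typed the total layer at `SGP`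
(K34-PLAN §3): `SGP ↦ SGPT'`, `thetaAdelicSideOfP_X ↦ thetaAdelicSideOfPT'_X`, `archSideOf ↦ archSideOfT'` (period-1 #P50b read-backs), six ν-families
added to every parameter pack, namespace `Gen12PinsP ↦ Gen12PinsP2`; statements and proofs otherwise VERBATIM; the pin-free helpers of `Binders/Real34ConcreteIns`
are NOT re-declared (that module is imported)), seat prover-pub-hodgecm-mc-binder-1-g13-0, 2026-08-20.
Target in PKG: HodgeCM/Model/Binders/Real34ConcreteInsP2.lean (NEW additive leaf).  KERNEL ONLY; 0 records of published theorems, nothing cited, 0 `def … : Prop`;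
MODEL-N ±0; E unchanged.  Nothing here is a claim of the manuscripts under adjudication.
-/
import Summits.HodgeConjecture.HodgeCM.Model.Binders.Real34ConcreteIns
import Summits.HodgeConjecture.HodgeCM.Model.Binders.Real34LetterDecompP2
import Summits.HodgeConjecture.HodgeCM.Model.HypCensus.SideWAssembly

/-!
**P2 RE-PIN (binder-1-g13) of `Binders/Real34ConcreteIns` at sinst-1's guarded doubly-twisted pin `SInstance.SGPT'` (R2 shape; E's `SROGT'C(J)` is an
instance).**  The module text below is the original's, to be read with `SGP ↦ SGPT'`, `AG : … lineRepD … ↦ … lineRepT' … ν ν'`, `archSideOf ↦ archSideOfT'`,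
`thetaAdelicSideOfP_X ↦ thetaAdelicSideOfPT'_X`, namespace `Gen12PinsP ↦ Gen12PinsP2`; pin-free helpers are imported from the original, not restated.
# The (34) insertion is a pure tensor: `ins₃₄ f φ = E₆ (archVec₃₄ φ ⊗ f)`

binder-2's (34) insertion of the census is `ins₃₄ f := ρ_η(1, h_∞) ∘ ins f` (`HypCensus/Side34Omg`), `ins f φ = E₆ (follandFock cmBigFrame
(insPoly φ) ⊗ f)` (`HypCensus/Ins`, `insRaw_apply`) and `ρ_η` at an ARCHIMEDEAN pair element acts on the archimedean slot
(`cmPairRepTwist_archProdHom_tmul`: `ρ_η(u_𝔸) E(Ψ ⊗ f) = η(u_𝔸) • E(ω_∞(u) Ψ ⊗ f)`).  Hence: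

* § 1 **`archVec₃₄ … φ`** `:= η(archProdHom (1, h)) • cmArchWeilRep (1, h) (follandFock cmBigFrame (insPoly φ))` (`h = isoTwistPin`) and
  **`ins₃₄_eq_tmul : ins₃₄ … f φ = E₆ (archVec₃₄ … φ ⊗ₜ f)`** — the hypothesis `hins` of RUN-48 #53 `Real34CensusSideT.ofTensorDecomp`
  for binder-2's core, with `Ψinf := archVec₃₄ … φ₀` and `F := f`;
* § 2 (guarded pins) **`Real34CensusSideT.ofConcreteIns`** — #53 with `hins` replaced by the identification `hcore` of the abstract core's
  insertion with `ins₃₄` (for binder-2's core term: `⟨f, rfl⟩`), so that the archimedean letter identity reads CONCRETELY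
  `harch : ∃ a, archVec₃₄ … φ₀ = a • (Tinf (Z₂ e₀^∨) (Z₃ e₁^∨) − Tinf (Z₂ e₁^∨) (Z₃ e₀^∨))`.

Row 17's residual after this leaf: (34) core TERM (+ `hcore`, `rfl` for it) ⊕ `htau`/`hTf` (pure-tensor shape of `tau34`) ⊕ `harch`
(the archimedean letter identity on the EXPLICIT vector `archVec₃₄ φ₀`) ⊕ (W-0-supply) ⊕ `IsLFAction`.
-/

set_option autoImplicit false

noncomputable section

open MeasureTheory NumberField MulAction IsDedekindDomain
open scoped NumberField
open scoped Matrix InnerProductSpace TensorProduct Classical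

attribute [-instance] Quotient.instMeasurableSpace

/-! ## 1. `ins₃₄` is a pure tensor -/

namespace HodgeCM.Model.HypCensus

open Literature.NumberTheory.Automorphic Literature.NumberTheory.Automorphic.UnitaryGroup Literature.NumberTheory.Weil1964
open Literature.NumberTheory.GelbartRogawski1991 Literature.NumberTheory.GelbartRogawski1991.UnitaryDualPair
open Literature.Analysis.SegalBargmann
open HodgeCM HodgeCM.Model HodgeCM.Adelic
open HodgeCM.PerL34.Fock HodgeCM.PerL34.Fock.PrintDict

section Pin

variable {L : CMField} {ι₁ : L →+* ℂ} (V : HermSpace3 L ι₁) (S : StubTree.SeesawDatum L)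
variable
  (hGR : (cmSplittingDatum (L : Type) finProdFinEquiv (frameD V) (frameD_real V) (frameD_ne V) (dW S) (dW_real S) (dW_ne S)).CompatibleSplitting)
  (η : CMAdelic (L : Type) (frameD V) × CMAdelic (L : Type) (dW S) →* ℂˣ)
variable (datum : ∀ b : InfinitePlace (L : Type),
  PlaceDatum (L : Type) (frameD V) (frameD_real V) (dW S) (dW_real S) ι₁ (cmPlacesEquiv (L : Type) b))
variable (m₁ m₂ : InfinitePlace (L : Type) → ℤ)

end Pin

end HodgeCM.Model.HypCensus

/-! ## 2. At the guarded pins: the census-T record with `hins` discharged -/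

namespace HodgeCM.Model

open HodgeCM HodgeCM.Universe HodgeCM.Adelic HodgeCM.Model.HypCensus
open HodgeCM.PerL34 HodgeCM.PerL34.Fock HodgeCM.PerL34.Fock.PrintDict HodgeCM.PerL34.Annihilation
open Literature.NumberTheory.Weil1964
open Literature.NumberTheory.Automorphic (piSchwartzBruhat FinSB thinCosetTestFunₗ piSchwartzBruhatEquiv)
open Literature.NumberTheory.GelbartRogawski1991.UnitaryDualPair
open Literature.AlgebraicGeometry.HodgeTheory
open Literature.AlgebraicGeometry.ShimuraVarieties
open Literature.NumberTheory.Automorphic.PicardCM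
open Literature.NumberTheory.Transcendental (Arapura2012_Cor_15_4_6)
open HodgeCM.Model.ThetaSpace HodgeCM.Model.ArchSideTerm HodgeCM.Model.SupplyInstance HodgeCM.Model.SupplyResidual
open NumberField.SeesawArchTorus (toAdeles printedTorusHom printedTorusHom_apply placesEquiv)
open HodgeCM.PerL34.Fock.LocalFock NumberField.SeesawTorus NumberField.SeesawArchTorus

namespace Gen12PinsP2

variable
  (G : ∀ {L : CMField} {ι₁ : L →+* ℂ} (_V : HermSpace3 L ι₁) (_c : SeesawCtx L), Prop)
  (hG : ∀ {L : CMField} {ι₁ : L →+* ℂ} (V : HermSpace3 L ι₁) (c : SeesawCtx L),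
    G V c → (∀ j, 0 < (ι₁ (dW c.D j)).re) ∨ ∀ j, (ι₁ (dW c.D j)).re < 0)
  (hGR : ∀ {L : CMField} {ι₁ : L →+* ℂ} (V : HermSpace3 L ι₁) (c : SeesawCtx L),
    (cmSplittingDatum (L : Type) finProdFinEquiv (frameD V) (frameD_real V) (frameD_ne V) (dW c.D) (dW_real c.D)
      (dW_ne c.D)).CompatibleSplitting)
  (η : ∀ {L : CMField} {ι₁ : L →+* ℂ} (V : HermSpace3 L ι₁) (c : SeesawCtx L),
    CMAdelic (L : Type) (frameD V) × CMAdelic (L : Type) (dW c.D) →* ℂˣ)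
  (hη : ∀ {L : CMField} {ι₁ : L →+* ℂ} (V : HermSpace3 L ι₁) (c : SeesawCtx L),
    ∀ γU ∈ CMRat (L : Type) (frameD V), ∀ γ ∈ CMRat (L : Type) (dW c.D), η V c (γU, γ) = 1)
  (hηc : ∀ {L : CMField} {ι₁ : L →+* ℂ} (V : HermSpace3 L ι₁) (c : SeesawCtx L), Continuous fun p => ((η V c p : ℂˣ) : ℂ))
  (ν : ∀ {L : CMField} {ι₁ : L →+* ℂ} (V : HermSpace3 L ι₁) (_c : SeesawCtx L), CMAdelic (L : Type) (frameD V) →* ℂˣ)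
  (hν : ∀ {L : CMField} {ι₁ : L →+* ℂ} (V : HermSpace3 L ι₁) (c : SeesawCtx L), ∀ γU ∈ CMRat (L : Type) (frameD V), ν V c γU = 1)
  (hνc : ∀ {L : CMField} {ι₁ : L →+* ℂ} (V : HermSpace3 L ι₁) (c : SeesawCtx L), Continuous fun v => ((ν V c v : ℂˣ) : ℂ))
  (ν' : ∀ {L : CMField} {ι₁ : L →+* ℂ} (V : HermSpace3 L ι₁) (_c : SeesawCtx L), CMAdelic (L : Type) (frameD V) →* ℂˣ)
  (hν' : ∀ {L : CMField} {ι₁ : L →+* ℂ} (V : HermSpace3 L ι₁) (c : SeesawCtx L), ∀ γU ∈ CMRat (L : Type) (frameD V), ν' V c γU = 1)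
  (hν'c : ∀ {L : CMField} {ι₁ : L →+* ℂ} (V : HermSpace3 L ι₁) (c : SeesawCtx L), Continuous fun v => ((ν' V c v : ℂˣ) : ℂ))
  (hGR₀ : ∀ {L : CMField} {ι₁ : L →+* ℂ} (V : HermSpace3 L ι₁) (c : SeesawCtx L),
    (cmSplittingDatum (L : Type) (e₁) (frameD V) (frameD_real V) (frameD_ne V) (lineVec (L : Type) (dW c.D 0))
      (fun _ => dW_real c.D 0) (fun _ => dW_ne c.D 0)).CompatibleSplitting)
  (hGR₁ : ∀ {L : CMField} {ι₁ : L →+* ℂ} (V : HermSpace3 L ι₁) (c : SeesawCtx L),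
    (cmSplittingDatum (L : Type) (e₁) (frameD V) (frameD_real V) (frameD_ne V) (lineVec (L : Type) (dW c.D 1))
      (fun _ => dW_real c.D 1) (fun _ => dW_ne c.D 1)).CompatibleSplitting)
  (hGR₂ : ∀ {L : CMField} {ι₁ : L →+* ℂ} (V : HermSpace3 L ι₁) (c : SeesawCtx L),
    (cmSplittingDatum (L : Type) (e₁) (frameD V) (frameD_real V) (frameD_ne V) (lineVec (L : Type) (dW' c.D 0))
      (fun _ => dW'_real c.D 0) (fun _ => dW'_ne c.D 0)).CompatibleSplitting)
  (hGR₃ : ∀ {L : CMField} {ι₁ : L →+* ℂ} (V : HermSpace3 L ι₁) (c : SeesawCtx L),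
    (cmSplittingDatum (L : Type) (e₁) (frameD V) (frameD_real V) (frameD_ne V) (lineVec (L : Type) (dW' c.D 1))
      (fun _ => dW'_real c.D 1) (fun _ => dW'_ne c.D 1)).CompatibleSplitting)
  (AG : ∀ {L : CMField} {ι₁ : L →+* ℂ} (V : HermSpace3 L ι₁) (c : SeesawCtx L), G V c → ∀ k : Fin 4,
    ArchLineInput V (lineRepT' V c.D (hGR V c) (hGR₀ V c) (hGR₁ V c) (hGR₂ V c) (hGR₃ V c) (η V c) (ν V c) (ν' V c) k))

variable (hHD : exists_isReal_hodgeModel) (hI : hodgePQ_independent_of_hodgeModel)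
  (h₁ : BallQuotientUniformised)  (h₃ : CMAbelianVarietyRealised)
  (h : Bool) (hA : Arapura2012_Cor_15_4_6) (μ : ∀ {L : CMField}, SeesawCtx L → Fin 4 → InfinitePlace L → ℤ)

section Context34

variable {L : CMField} {ι₁ : L →+* ℂ} (V : HermSpace3 L ι₁) (c : SeesawCtx L) (hV : IsAnisotropic L V.Hm)

/-- **`Real34CensusSideT` with `hins` DISCHARGED**: for a (34) census core whose insertion IS binder-2's `ins₃₄` on the base vector
(`hcore`: for binder-2's core term, `⟨f, rfl⟩`), the record follows from LF-continuity, (W-0-supply), the pure-tensor shape of `tau34`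
(`htau`, `hTf`) and the archimedean letter identity `harch` on the EXPLICIT vector `archVec₃₄ … φ₀`. -/
def Real34CensusSideT.ofConcreteIns (hW : IsAnisotropic L c.D.gramW) (hs : (∀ j, 0 < (ι₁ (dW c.D j)).re) ∨ ∀ j, (ι₁ (dW c.D j)).re < 0)
    (jD : InfinitePlace (L : Type) → EqVar → Fin 6)
    (core : HypCoreW ((Gen12Pins.Wg @hGR @η @hη @hηc @Gen12Pins.τSyl @Gen12Pins.TSyl @Gen12Pins.hTSyl) V c) c.D.jT₃₄ (fun w => -μ c 2 w) (fun w => -μ c 3 w))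
    (hcore : letI := core.decEq
      ∀ f : core.side.FinIdx, ∃ g : FinSB ↥(maximalRealSubfield L) (Fin 6),
        (core.side.ins f (printPlaces (InfinitePlace (L : Type)) core.kind core.lam core.hlam
            (pinnedVacs core.kind (fun w => -μ c 2 w) (fun w => -μ c 3 w))).φ₀ : piSchwartzBruhat (↥(maximalRealSubfield L)) (Fin 6)) =
          ins₃₄ V c.D (hGR V c) (η V c) (datumAt V c.D jD (jIOf V c.D hs)) (fun w => -μ c 2 w) (fun w => -μ c 3 w) g
            (printedAt V c.D hs jD (fun w => -μ c 2 w) (fun w => -μ c 3 w)).φ₀)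
    (Z₂ Z₃ : Module.Dual ℂ (thetaSpaceInputIn hHD hI h₁ h₃ ((SInstance.SGPT' @G @hG @hGR @η @hη @hηc @ν @hν @hνc @ν' @hν' @hν'c @hGR₀ @hGR₁ @hGR₂ @hGR₃ @AG) V c) hV).W →ₗ[ℂ]
      SchwartzMap ((thetaSpaceInputIn hHD hI h₁ h₃ ((SInstance.SGPT' @G @hG @hGR @η @hη @hηc @ν @hν @hνc @ν' @hν' @hν'c @hGR₀ @hGR₁ @hGR₂ @hGR₃ @AG) V c) hV).J →
        mixedEmbedding.mixedSpace (thetaSpaceInputIn hHD hI h₁ h₃ ((SInstance.SGPT' @G @hG @hGR @η @hη @hηc @ν @hν @hνc @ν' @hν' @hν'c @hGR₀ @hGR₁ @hGR₂ @hGR₃ @AG) V c) hV).K) ℂ)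
    (hLF₂ : ((thetaSpaceInputIn hHD hI h₁ h₃ ((SInstance.SGPT' @G @hG @hGR @η @hη @hηc @ν @hν @hνc @ν' @hν' @hν'c @hGR₀ @hGR₁ @hGR₂ @hGR₃ @AG) V c) hV).P 2).IsLFAction)
    (hLF₃ : ((thetaSpaceInputIn hHD hI h₁ h₃ ((SInstance.SGPT' @G @hG @hGR @η @hη @hηc @ν @hν @hνc @ν' @hν' @hν'c @hGR₀ @hGR₁ @hGR₂ @hGR₃ @AG) V c) hV).P 3).IsLFAction)
    (hsupply : ∀ (x₂ x₃ : Fin 3 → FiniteAdeleRing (𝓞 ↥(maximalRealSubfield L)) ↥(maximalRealSubfield L))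
        (𝔫₂ 𝔫₃ : Ideal (𝓞 ↥(maximalRealSubfield L))),
      ∃ (B₂ : ArchKTypeDataAt (thetaSpaceInputIn hHD hI h₁ h₃ ((SInstance.SGPT' @G @hG @hGR @η @hη @hηc @ν @hν @hνc @ν' @hν' @hν'c @hGR₀ @hGR₁ @hGR₂ @hGR₃ @AG) V c) hV) 2 x₂ 𝔫₂)
        (B₃ : ArchKTypeDataAt (thetaSpaceInputIn hHD hI h₁ h₃ ((SInstance.SGPT' @G @hG @hGR @η @hη @hηc @ν @hν @hνc @ν' @hν' @hν'c @hGR₀ @hGR₁ @hGR₂ @hGR₃ @AG) V c) hV) 3 x₃ 𝔫₃),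
        B₃.Γ₀ = B₂.Γ₀ ∧ B₂.Φarch = Z₂ ∧ B₃.Φarch = Z₃ ∧
          B₂.IsWeaklyPDiff BallForms.expP ∧
          (∀ p : Fin 2, B₂.IsPMinusKilledAlong BallForms.expP (-Complex.I • (Pi.single p 1 : Fin 2 → ℂ))) ∧
          B₃.IsWeaklyPDiff BallForms.expP ∧
          (∀ p : Fin 2, B₃.IsPMinusKilledAlong BallForms.expP (-Complex.I • (Pi.single p 1 : Fin 2 → ℂ))))
    (Tinf : SchwartzMap (Fin 3 → mixedEmbedding.mixedSpace ↥(maximalRealSubfield L)) ℂ →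
      SchwartzMap (Fin 3 → mixedEmbedding.mixedSpace ↥(maximalRealSubfield L)) ℂ →
        SchwartzMap (Fin 6 → mixedEmbedding.mixedSpace ↥(maximalRealSubfield L)) ℂ)
    (Tf : FinSB ↥(maximalRealSubfield L) (Fin 3) →ₗ[ℂ] FinSB ↥(maximalRealSubfield L) (Fin 3) →ₗ[ℂ] FinSB ↥(maximalRealSubfield L) (Fin 6))
    (htau : ∀ (Φ₂ Φ₃ : SchwartzMap (Fin 3 → mixedEmbedding.mixedSpace ↥(maximalRealSubfield L)) ℂ) (F₂ F₃ : FinSB ↥(maximalRealSubfield L) (Fin 3)),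
      tau34 V c.D (piSchwartzBruhatEquiv ↥(maximalRealSubfield L) (Fin 3) (Φ₂ ⊗ₜ F₂))
          (piSchwartzBruhatEquiv ↥(maximalRealSubfield L) (Fin 3) (Φ₃ ⊗ₜ F₃)) =
        piSchwartzBruhatEquiv ↥(maximalRealSubfield L) (Fin 6) (Tinf Φ₂ Φ₃ ⊗ₜ Tf F₂ F₃))
    (hTf : Submodule.span ℂ (Set.range fun p : FinSB ↥(maximalRealSubfield L) (Fin 3) × FinSB ↥(maximalRealSubfield L) (Fin 3) =>
      Tf p.1 p.2) = ⊤)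
    (harch : ∃ a : ℂ,
      archVec₃₄ V c.D (hGR V c) (η V c) (datumAt V c.D jD (jIOf V c.D hs)) (fun w => -μ c 2 w) (fun w => -μ c 3 w)
          (printedAt V c.D hs jD (fun w => -μ c 2 w) (fun w => -μ c 3 w)).φ₀ =
        a • (Tinf (Z₂ (LinearMap.proj 0)) (Z₃ (LinearMap.proj 1)) - Tinf (Z₂ (LinearMap.proj 1)) (Z₃ (LinearMap.proj 0)))) :
    Real34CensusSideT @G @hG @hGR @η @hη @hηc @ν @hν @hνc @ν' @hν' @hν'c @hGR₀ @hGR₁ @hGR₂ @hGR₃ @AG hHD hI h₁ h₃ h hA @μ V c hV :=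
  Real34CensusSideT.ofTensorDecomp @G @hG @hGR @η @hη @hηc @ν @hν @hνc @ν' @hν' @hν'c @hGR₀ @hGR₁ @hGR₂ @hGR₃ @AG hHD hI h₁ h₃ h hA @μ V c hV hW core Z₂ Z₃
    hLF₂ hLF₃ hsupply Tinf Tf htau hTf _ harch (by
      letI := core.decEq
      intro f
      obtain ⟨g, hg⟩ := hcore f
      exact ⟨g, hg.trans (ins₃₄_eq_tmul V c.D (hGR V c) (η V c) _ _ _ g _)⟩)

end Context34

end Gen12PinsP2

end HodgeCM.Model

end
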